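import Summits.PneNP.PneNP.Theorems.PeaWorstToAvg.Negative.AdviceElimLoadBearing
import Summits.PneNP.PneNP.Theorems.SzkEntropyPeaWorstToAvgDualModeCompileDefs
import Literature.Computability.Complexity.BranchingFn

/-!
# PneNP / SzkEntropy — crux `PeaWorstToAvg` (stmt-PneNP-10777), negative side: DISJOINTNESS of the promise
# problem and EFFICIENCY of the samplers are LOAD-BEARING in the advice-elimination stub

Drefute content for the shared stub `stub_adviceElim` of the lines `orbit-pair-rsr` / `dual-mode-compile`
(skeletons under `Cruxes/PeaWorstToAvg/Lines/`; uniform schemes `UHeurBPP` of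
`SzkEntropyPeaWorstToAvgDualModeCompileDefs.lean`), complementing `AdviceElimLoadBearing.lean` (labels and
samplability are load-bearing) and `AdviceElimHonestBudget.lean` (the samplers' honest budget is):

* `adviceElim_false_without_disjoint` — `stub_adviceElim` WITHOUT `hQ : Q.Disjoint` (everything else verbatim:
  uniform honest-budget samplers, certified `supp S false ⊆ Q.no`, `supp S true ⊆ Q.yes`, `HeurBPP`-membership,
  conclusion `∈ UHeurBPP`) is FALSE: take `Q.no = univ` (so the NO-certificate is void), `Q.yes` a size-class
  language `{x | a (size |x|)}` with `a (3t) = 1`, `S true` the constant sampler `[]` (size class `0`, always YES,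
  `nilSampler_props`) and `S false` the unary identity `1ⁿ ↦ 1ⁿ`; the mixture is `HeurBPP`-easy by `coinLen`
  advice (`mem_HeurBPP_sizeClass`) while a uniform scheme must answer `a (3t+2) = c t` on the atom `1ⁿ`,
  `n = 2^{3t+2}/2`, at `m = 4` — for every `c : ℕ → Bool`, against countability of uniform schemes.
  MEANING: the NO-labels are informative only through `hQ` (`Q.no ⊆ (Q.yes)ᶜ`); any proof must use it there.
* `adviceElim_false_without_polyTime` — `stub_adviceElim` WITHOUT `hS` (polynomial time of the samplers; the
  honest budget `hc`, labels, disjointness KEPT) is FALSE: the point-mass witnesses of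
  `adviceElim_false_without_samplability` (interleaved key, the `c`-dependent atom `1^{2^{3t+2}/2}` placed on its
  correct side at parameter `t`) ARE laws of coin-free `RandAlg.ofDet` samplers with budget `0` — merely not
  polynomial-time ones (the atoms have exponential length).  So it is the samplers' EFFICIENCY, not only the
  dyadic/algorithmic form of the component laws, that a proof must use (to draw its own test samples in time).

References: A. Bogdanov, L. Trevisan, *Average-Case Complexity*, FnT–TCS 2 (2006), Def. 2.1, 2.12–2.13;
S. Arora, B. Barak, *Computational Complexity* (2009), §1.4, §6.3, Def. 7.1–7.3; R. Karp, R. Lipton,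
*Turing machines that take advice*, Enseign. Math. 28 (1982).
-/

namespace Summit.PneNP.PneNP.Theorems

set_option linter.dupNamespace false -- `Summit.PneNP.PneNP.…`: summit = sub-problem name (D-0017)

open Literature.Computability.Complexity Literature.Computability.MetaComplexity
open _root_.Computability
open Summit.PneNP.PneNP.Cruxes.PeaWorstToAvg.DualModeCompile (UHeurBPP)
open scoped ENNReal

/-! ### The constant sampler `1ⁿ ↦ []` -/

/-- The coin-free CONSTANT sampler `1ⁿ ↦ []` is a uniform polynomial-time sampler (coin budget the zero
polynomial) with law `δ_{[]}`. [BogdanovTrevisan2006, Def. 2.1] -/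
theorem nilSampler_props :
    (RandAlg.ofDet fun _ : ℕ => ([] : List Bool)).IsPolyTime unaryEncodeNat (id : List Bool → List Bool) ∧
      (∀ ℓ, (RandAlg.ofDet fun _ : ℕ => ([] : List Bool)).coinLen ℓ = (0 : Polynomial ℕ).eval ℓ) ∧
      ∀ n, (RandAlg.ofDet fun _ : ℕ => ([] : List Bool)).outputPMF unaryEncodeNat n = PMF.pure [] := by
  refine ⟨RandAlg.IsPolyTime.ofDet_holds ?_, fun ℓ => by simp [RandAlg.ofDet], fun n =>
    RandAlg.outputPMF_ofDet _ _ _⟩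
  exact PolyTimeComputable.of_encode_eq (f := fun _ : List Bool => ([] : List Bool)) unaryEncodeNat
    (fun _ => rfl) (fun _ => rfl) (const_mem_FP [])

/-! ### `stub_adviceElim` is FALSE without disjointness of the promise problem -/

/-- **`stub_adviceElim` WITHOUT `Q.Disjoint` is FALSE** (line `orbit-pair-rsr` / `dual-mode-compile`, shared
stub; all other hypotheses verbatim, conclusion `∈ UHeurBPP`).  Witness family (`c : ℕ → Bool`): `a`
interleaves `a(3t)=1, a(3t+1)=0, a(3t+2)=c t`; `Q = ({x | a(size|x|)}, univ)`; `S true = (1ⁿ ↦ [])` (the empty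
word has size class `0`, a YES instance), `S false = (1ⁿ ↦ 1ⁿ)` (certified NO for free); both coin-free, common
budget `0`.  The mixture `½δ_{[]} + ½δ_{1ⁿ}` is `HeurBPP`-easy (`mem_HeurBPP_sizeClass`), and a uniform scheme at
`(n, m) = (2^{3t+2}/2, 4)` cannot have the atom `1ⁿ` (mass `≥ 1/2 > 1/4`) in its bad set, so its majority answer
there is `a(3t+2) = c t`: `c ↦ scheme` would inject `ℕ → Bool` into the countable set of uniform schemes
(`false_of_injective_uniformSchemes`).  Hence the NO-labels of `stub_adviceElim` are informative only through
`hQ`; a proof must use it. [BogdanovTrevisan2006, Def. 2.12–2.13; AroraBarakCC2009, §6.3; KarpLipton1982] -/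
theorem adviceElim_false_without_disjoint :
    ¬ ∀ (Q : PromiseProblem) (S : Bool → RandAlg ℕ (List Bool)),
      (∀ b, (S b).IsPolyTime unaryEncodeNat (id : List Bool → List Bool)) →
      ∀ c : Polynomial ℕ, (∀ b ℓ, (S b).coinLen ℓ = c.eval ℓ) →
      (∀ n, ∀ w ∈ ((S false).outputPMF unaryEncodeNat n).support, w ∈ Q.no) →
      (∀ n, ∀ w ∈ ((S true).outputPMF unaryEncodeNat n).support, w ∈ Q.yes) →
      (⟨Q.yes, mixEnsemble (fun n => (S false).outputPMF unaryEncodeNat n)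
          (fun n => (S true).outputPMF unaryEncodeNat n)⟩ : DistProblem) ∈ HeurBPP →
      (⟨Q.yes, mixEnsemble (fun n => (S false).outputPMF unaryEncodeNat n)
          (fun n => (S true).outputPMF unaryEncodeNat n)⟩ : DistProblem) ∈ UHeurBPP := by
  intro H
  obtain ⟨hU, hUc, hUlaw⟩ := unarySampler_props
  obtain ⟨hN, hNc, hNlaw⟩ := nilSampler_props
  -- strings of prescribed size class
  let w : ℕ → List Bool := fun s => unaryEncodeNat (2 ^ s / 2)
  have hw : ∀ s, (w s).length.size = s := fun s => by
    show (unaryEncodeNat (2 ^ s / 2)).length.size = s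
    rw [show (unaryEncodeNat (2 ^ s / 2)).length = 2 ^ s / 2 from unary_decode_encode_nat _]
    exact size_two_pow_div_two s
  -- for every `c`, a uniform scheme whose key is `c`
  have key : ∀ c : ℕ → Bool, ∃ A : RandAlg (List Bool × ℕ × ℕ) Bool,
      (A.IsPolyTime schemeEnc encodeBool ∧ ∃ c : Polynomial ℕ, ∀ ℓ, A.coinLen ℓ = c.eval ℓ) ∧
      ∀ t, decide ((1 : ℝ) / 2 <
        ((A.outputPMF schemeEnc (w (3 * t + 2), 2 ^ (3 * t + 2) / 2, 4)) true).toReal) = c t := by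
    intro c
    obtain ⟨a, ha0, -, ha2⟩ := interleave_spec c
    let L : Set (List Bool) := {x | a x.length.size = true}
    have hmemL : ∀ s, w s ∈ L ↔ a s = true := fun s => by
      show a (w s).length.size = true ↔ a s = true
      rw [hw]
    -- the two samplers: `false ↦` unary identity (certified NO vacuously), `true ↦ []` (size class 0, YES)
    let S : Bool → RandAlg ℕ (List Bool) := fun b =>
      if b then RandAlg.ofDet (fun _ : ℕ => ([] : List Bool)) else RandAlg.ofDet fun n : ℕ => unaryEncodeNat n
    have hSf : S false = RandAlg.ofDet (fun n : ℕ => unaryEncodeNat n) := rfl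
    have hSt : S true = RandAlg.ofDet (fun _ : ℕ => ([] : List Bool)) := rfl
    have hS : ∀ b, (S b).IsPolyTime unaryEncodeNat (id : List Bool → List Bool) := by
      intro b; cases b
      · rw [hSf]; exact hU
      · rw [hSt]; exact hN
    have hc : ∀ b ℓ, (S b).coinLen ℓ = (0 : Polynomial ℕ).eval ℓ := by
      intro b ℓ; cases b
      · rw [hSf]; exact hUc ℓ
      · rw [hSt]; exact hNc ℓ
    have h₀ : ∀ n, ∀ x ∈ ((S false).outputPMF unaryEncodeNat n).support,
        x ∈ (⟨L, Set.univ⟩ : PromiseProblem).no := fun _ _ _ => Set.mem_univ _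
    have h₁ : ∀ n, ∀ x ∈ ((S true).outputPMF unaryEncodeNat n).support,
        x ∈ (⟨L, Set.univ⟩ : PromiseProblem).yes := by
      intro n x hx
      rw [hSt, hNlaw n, PMF.support_pure, Set.mem_singleton_iff] at hx
      subst hx
      show a ([] : List Bool).length.size = true
      simpa using ha0 0
    obtain ⟨A, hA, hAc, hbad⟩ := H ⟨L, Set.univ⟩ S hS 0 hc h₀ h₁ (mem_HeurBPP_sizeClass a _)
    refine ⟨A, ⟨hA, hAc⟩, fun t => ?_⟩
    set n : ℕ := 2 ^ (3 * t + 2) / 2 with hn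
    have hwn : w (3 * t + 2) = unaryEncodeNat n := rfl
    -- the atom `1ⁿ` carries mixture mass `≥ 1/2` at parameter `n`
    have hatom : (2 : ℝ≥0∞)⁻¹ ≤ (mixEnsemble (fun n => (S false).outputPMF unaryEncodeNat n)
        (fun n => (S true).outputPMF unaryEncodeNat n) n).toOuterMeasure {w (3 * t + 2)} := by
      rw [toOuterMeasure_mixEnsemble]
      have : ((S false).outputPMF unaryEncodeNat n).toOuterMeasure {w (3 * t + 2)} = 1 := by
        rw [hSf, hUlaw n, hwn, PMF.toOuterMeasure_pure_apply, if_pos (Set.mem_singleton _)]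
      rw [this, mul_one]
      exact le_self_add
    -- hence it is not bad at `m = 4`
    have hgood : A.pr schemeEnc (w (3 * t + 2), n, 4) {b | b ≠ L.boolIndicator (w (3 * t + 2))} < 1 / 4 := by
      by_contra hb
      push Not at hb
      have h4 := hbad n 4 (by norm_num)
      have hsub : {w (3 * t + 2)} ⊆
          {x | 1 / 4 ≤ A.pr schemeEnc (x, n, 4) {b | b ≠ L.boolIndicator x}} := by
        rintro _ rfl
        exact hb
      have hle : (2 : ℝ≥0∞)⁻¹ ≤ (mixEnsemble (fun n => (S false).outputPMF unaryEncodeNat n)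
          (fun n => (S true).outputPMF unaryEncodeNat n) n).toOuterMeasure
          {x | 1 / 4 ≤ A.pr schemeEnc (x, n, 4) {b | b ≠ L.boolIndicator x}} :=
        hatom.trans (PMF.toOuterMeasure_mono _ fun x hx => hsub hx.1)
      have hreal : (1 : ℝ) / 2 ≤ (mixEnsemble (fun n => (S false).outputPMF unaryEncodeNat n)
          (fun n => (S true).outputPMF unaryEncodeNat n)).prob n
          {x | 1 / 4 ≤ A.pr schemeEnc (x, n, 4) {b | b ≠ L.boolIndicator x}} := by
        rw [Ensemble.prob]
        have := ENNReal.toReal_mono (ne_top_of_le_ne_top ENNReal.one_ne_top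
          (PMF.toOuterMeasure_mono _ (Set.subset_univ _) |>.trans_eq
            ((PMF.toOuterMeasure_apply_eq_one_iff _ _).2 (Set.subset_univ _)))) hle
        simpa using this
      have h4' : (mixEnsemble (fun n => (S false).outputPMF unaryEncodeNat n)
          (fun n => (S true).outputPMF unaryEncodeNat n)).prob n
          {x | 1 / 4 ≤ A.pr schemeEnc (x, n, 4) {b | b ≠ L.boolIndicator x}} ≤ 1 / 4 := h4
      linarith
    -- read the key off
    have hind : L.boolIndicator (w (3 * t + 2)) = c t := by
      cases h : c t
      · exact (Set.notMem_iff_boolIndicator _ _).1 (by rw [hmemL, ha2, h]; exact Bool.false_ne_true)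
      · exact (Set.mem_iff_boolIndicator _ _).1 (by rw [hmemL, ha2, h])
    rw [hind, pr_ne_eq_toReal_apply_not] at hgood
    rw [hwn]
    cases h : c t
    · rw [h] at hgood
      simp only [Bool.not_false] at hgood
      rw [decide_eq_false_iff_not, not_lt]
      linarith
    · rw [h] at hgood
      simp only [Bool.not_true] at hgood
      rw [decide_eq_true_iff, toReal_apply_true_eq]
      linarith
  -- countability contradiction
  choose A hA using key
  have hinj : Function.Injective A := fun c c' h => by
    funext t
    rw [← (hA c).2 t, ← (hA c').2 t, h]
  exact false_of_injective_uniformSchemes A hinj fun c => (hA c).1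

/-! ### `stub_adviceElim` is FALSE without polynomial time of the samplers -/

/-- **`stub_adviceElim` WITHOUT `hS` is FALSE** (honest budget `0`, labels and disjointness kept): coin-free
`RandAlg.ofDet` samplers realise the point-mass witnesses of `adviceElim_false_without_samplability` — for
`c : ℕ → Bool`, `a` interleaved, `Q = ({x | a(size|x|)}, its complement)`, `S true (1ᵗ) = w(3t+2)` if `c t` else
`w(3t)`, `S false (1ᵗ) = w(3t+1)` if `c t` else `w(3t+2)` (`w s = 1^{2^s/2}`, size class `s`); a uniform scheme at
`(t, 4)` must answer `c t` on `w(3t+2)`. [BogdanovTrevisan2006, Def. 2.1, 2.12–2.13; AroraBarakCC2009, §6.3;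
KarpLipton1982] -/
theorem adviceElim_false_without_polyTime :
    ¬ ∀ (Q : PromiseProblem), Q.Disjoint → ∀ (S : Bool → RandAlg ℕ (List Bool)),
      ∀ c : Polynomial ℕ, (∀ b ℓ, (S b).coinLen ℓ = c.eval ℓ) →
      (∀ n, ∀ w ∈ ((S false).outputPMF unaryEncodeNat n).support, w ∈ Q.no) →
      (∀ n, ∀ w ∈ ((S true).outputPMF unaryEncodeNat n).support, w ∈ Q.yes) →
      (⟨Q.yes, mixEnsemble (fun n => (S false).outputPMF unaryEncodeNat n)
          (fun n => (S true).outputPMF unaryEncodeNat n)⟩ : DistProblem) ∈ HeurBPP →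
      (⟨Q.yes, mixEnsemble (fun n => (S false).outputPMF unaryEncodeNat n)
          (fun n => (S true).outputPMF unaryEncodeNat n)⟩ : DistProblem) ∈ UHeurBPP := by
  intro H
  -- strings of prescribed size class
  let w : ℕ → List Bool := fun s => unaryEncodeNat (2 ^ s / 2)
  have hw : ∀ s, (w s).length.size = s := fun s => by
    show (unaryEncodeNat (2 ^ s / 2)).length.size = s
    rw [show (unaryEncodeNat (2 ^ s / 2)).length = 2 ^ s / 2 from unary_decode_encode_nat _]
    exact size_two_pow_div_two s
  -- for every `c`, a uniform scheme whose key is `c`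
  have key : ∀ c : ℕ → Bool, ∃ A : RandAlg (List Bool × ℕ × ℕ) Bool,
      (A.IsPolyTime schemeEnc encodeBool ∧ ∃ c : Polynomial ℕ, ∀ ℓ, A.coinLen ℓ = c.eval ℓ) ∧
      ∀ t, decide ((1 : ℝ) / 2 < ((A.outputPMF schemeEnc (w (3 * t + 2), t, 4)) true).toReal) = c t := by
    intro c
    obtain ⟨a, ha0, ha1, ha2⟩ := interleave_spec c
    let L : Set (List Bool) := {x | a x.length.size = true}
    have hmemL : ∀ s, w s ∈ L ↔ a s = true := fun s => by
      show a (w s).length.size = true ↔ a s = true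
      rw [hw]
    -- the two coin-free samplers and their (point-mass) laws
    let g : Bool → ℕ → List Bool := fun b t =>
      if b then (if c t then w (3 * t + 2) else w (3 * t)) else (if c t then w (3 * t + 1) else w (3 * t + 2))
    let S : Bool → RandAlg ℕ (List Bool) := fun b => RandAlg.ofDet (g b)
    have hlaw : ∀ b t, (S b).outputPMF unaryEncodeNat t = PMF.pure (g b t) := fun b t =>
      RandAlg.outputPMF_ofDet _ _ _
    have hc : ∀ b ℓ, (S b).coinLen ℓ = (0 : Polynomial ℕ).eval ℓ := fun b ℓ => by simp [S, RandAlg.ofDet]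
    have h₁ : ∀ n, ∀ x ∈ ((S true).outputPMF unaryEncodeNat n).support, x ∈ (⟨L, Lᶜ⟩ : PromiseProblem).yes := by
      intro n x hx
      rw [hlaw, PMF.support_pure, Set.mem_singleton_iff] at hx
      subst hx
      show g true n ∈ L
      simp only [g, if_true]
      cases hcn : c n
      · simpa [hmemL] using ha0 n
      · simp only [if_true]
        rw [hmemL, ha2, hcn]
    have h₀ : ∀ n, ∀ x ∈ ((S false).outputPMF unaryEncodeNat n).support, x ∈ (⟨L, Lᶜ⟩ : PromiseProblem).no := by
      intro n x hx
      rw [hlaw, PMF.support_pure, Set.mem_singleton_iff] at hx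
      subst hx
      show g false n ∈ Lᶜ
      rw [Set.mem_compl_iff]
      simp only [g, Bool.false_eq_true, if_false]
      cases hcn : c n
      · simp only [Bool.false_eq_true, if_false]
        rw [hmemL, ha2, hcn]
        exact Bool.false_ne_true
      · simp only [if_true]
        rw [hmemL, ha1]
        exact Bool.false_ne_true
    have hQ : (⟨L, Lᶜ⟩ : PromiseProblem).Disjoint := disjoint_compl_right
    obtain ⟨A, hA, hAc, hbad⟩ := H ⟨L, Lᶜ⟩ hQ S 0 hc h₀ h₁ (mem_HeurBPP_sizeClass a _)
    refine ⟨A, ⟨hA, hAc⟩, fun t => ?_⟩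
    -- the `c`-dependent atom `w (3t+2)` is an atom of the mixture, hence not bad at `m = 4`
    have hatom : (2 : ℝ≥0∞)⁻¹ ≤ (mixEnsemble (fun n => (S false).outputPMF unaryEncodeNat n)
        (fun n => (S true).outputPMF unaryEncodeNat n) t).toOuterMeasure {w (3 * t + 2)} := by
      rw [toOuterMeasure_mixEnsemble]
      cases hct : c t
      · have : ((S false).outputPMF unaryEncodeNat t).toOuterMeasure {w (3 * t + 2)} = 1 := by
          rw [hlaw]
          simp [g, hct]
        rw [this, mul_one]
        exact le_self_add
      · have : ((S true).outputPMF unaryEncodeNat t).toOuterMeasure {w (3 * t + 2)} = 1 := by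
          rw [hlaw]
          simp [g, hct]
        rw [this, mul_one]
        exact le_add_self
    have hgood : A.pr schemeEnc (w (3 * t + 2), t, 4) {b | b ≠ L.boolIndicator (w (3 * t + 2))} < 1 / 4 := by
      by_contra hb
      push Not at hb
      have h4 := hbad t 4 (by norm_num)
      have hsub : {w (3 * t + 2)} ⊆ {x | 1 / 4 ≤ A.pr schemeEnc (x, t, 4) {b | b ≠ L.boolIndicator x}} := by
        rintro _ rfl
        exact hb
      have hle : (2 : ℝ≥0∞)⁻¹ ≤ (mixEnsemble (fun n => (S false).outputPMF unaryEncodeNat n)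
          (fun n => (S true).outputPMF unaryEncodeNat n) t).toOuterMeasure
          {x | 1 / 4 ≤ A.pr schemeEnc (x, t, 4) {b | b ≠ L.boolIndicator x}} :=
        hatom.trans (PMF.toOuterMeasure_mono _ fun x hx => hsub hx.1)
      have hreal : (1 : ℝ) / 2 ≤ (mixEnsemble (fun n => (S false).outputPMF unaryEncodeNat n)
          (fun n => (S true).outputPMF unaryEncodeNat n)).prob t
          {x | 1 / 4 ≤ A.pr schemeEnc (x, t, 4) {b | b ≠ L.boolIndicator x}} := by
        rw [Ensemble.prob]
        have := ENNReal.toReal_mono (ne_top_of_le_ne_top ENNReal.one_ne_top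
          (PMF.toOuterMeasure_mono _ (Set.subset_univ _) |>.trans_eq
            ((PMF.toOuterMeasure_apply_eq_one_iff _ _).2 (Set.subset_univ _)))) hle
        simpa using this
      have h4' : (mixEnsemble (fun n => (S false).outputPMF unaryEncodeNat n)
          (fun n => (S true).outputPMF unaryEncodeNat n)).prob t
          {x | 1 / 4 ≤ A.pr schemeEnc (x, t, 4) {b | b ≠ L.boolIndicator x}} ≤ 1 / 4 := h4
      linarith
    -- read the key off
    have hind : L.boolIndicator (w (3 * t + 2)) = c t := by
      cases h : c t
      · exact (Set.notMem_iff_boolIndicator _ _).1 (by rw [hmemL, ha2, h]; exact Bool.false_ne_true)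
      · exact (Set.mem_iff_boolIndicator _ _).1 (by rw [hmemL, ha2, h])
    rw [hind, pr_ne_eq_toReal_apply_not] at hgood
    cases h : c t
    · rw [h] at hgood
      simp only [Bool.not_false] at hgood
      rw [decide_eq_false_iff_not, not_lt]
      linarith
    · rw [h] at hgood
      simp only [Bool.not_true] at hgood
      rw [decide_eq_true_iff, toReal_apply_true_eq]
      linarith
  -- countability contradiction
  choose A hA using key
  have hinj : Function.Injective A := fun c c' h => by
    funext t
    rw [← (hA c).2 t, ← (hA c').2 t, h]
  exact false_of_injective_uniformSchemes A hinj fun c => (hA c).1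

end Summit.PneNP.PneNP.Theorems
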